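import Literature.AlgebraicTopology.SingularHomology.OrbitMapCohomology
import Literature.AlgebraicTopology.SingularHomology.CechTautness
import HarnessLib

/-!
# Orbit maps of finite group actions: the transfer in the subset model, by Mayer–Vietoris over
# shrinking neighbourhoods of the branch locus and tautness (towards Bredon II.19.2)

Topic `Literature/AlgebraicTopology/SingularHomology`. Second of three files (after
`OrbitMapCohomology.lean`; statement and context in `SemiFreeQuotientTransfer.lean`). Setting: a
finite group `G` acting continuously on a compact Hausdorff `Z`, `q : Z → Y` a continuous
surjection onto a Hausdorff `Y` whose fibres are the `G`-orbits, `F ⊆ Z` closed, `G`-stable and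
containing every point with non-trivial stabiliser, `B = q(F)`, `U = Y ∖ B`.

* §3 `OrbitMap.qH_mvδ`, `OrbitMap.act_mvδ` — `q^*` commutes with the Mayer–Vietoris connecting
  maps of `(A, B)` and `(q⁻¹A, q⁻¹B)`, and the latter is `G`-equivariant (`mvδ_pull`,
  `mvδ_natural`);
* §4 tautness in use (`exists_resH_eq_zero_of_taut`, `exists_resH_eq_of_taut`: Spanier Thm. 6.1.10
  through the tree's `Cech.RetractionNhds.injective_toSubset` / `surjective_toSubset`), and
  COFINALITY: every neighbourhood of `F` contains some `q⁻¹W`, `W ⊇ B` open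
  (`exists_nhd_preimage_subset`);
* §5 the theorem in the subset model: `OrbitMap.qH_univ_injective` — `q^* : H^p_Y(Y) → H^p_Z(Z)` is
  injective — and `OrbitMap.exists_qH_univ_eq` — every `G`-invariant class is a `q^*` — under the
  hypotheses: `F` and `B` taut (`Cech.RetractionNhds`) and the transfer available on `F` itself
  (`q^* : H_Y(B) → H_Z(F)` injective with every invariant class in its range). The proofs are the
  five-lemma chases for the ladder of Mayer–Vietoris sequences of `Y = U ∪ W`, `Z = q⁻¹U ∪ q⁻¹W`,
  run over SHRINKING neighbourhoods `W` of `B` (finitely many shrinkings instead of a direct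
  limit): the free case (§2) on `U` and `U ∩ W`, tautness + transfer on `F` near `B`
  (`exists_shrink_eq_zero`, `exists_shrink_eq_qH`), invariants by averaging.

Everything is proved; no named facts, no instances.

## References

* [Bredon1997] G. E. Bredon, *Sheaf Theory*, 2nd ed., GTM 170 (1997), II Thm. 19.2.
* [HatcherAT2002] A. Hatcher, *Algebraic Topology*, CUP 2002, §3.1 pp. 203–204 (Mayer–Vietoris).
* [Spanier1981] E. H. Spanier, *Algebraic Topology*, Ch. 6 §1 Thm. 10 (tautness).
-/

noncomputable section

-- as in `SubsetCochainsComparisonPull`: chains of the concrete complex are `Finsupp`s up to unfolding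
set_option backward.isDefEq.respectTransparency false

open CategoryTheory Limits Set Function
open _root_.Topology

universe u v w

namespace Literature.AlgebraicTopology.SingularHomology

namespace OrbitMap

open subsetCochains

variable {R : Type v} [Field R]

variable {G : Type w} [Group G] {Z Y : Type u} [TopologicalSpace Z] [TopologicalSpace Y]
  [MulAction G Z] [ContinuousConstSMul G Z] (q : C(Z, Y))
  (horb : ∀ z z' : Z, q z = q z' ↔ ∃ g : G, g • z = z')

/-! ### §3 Equivariance of the Mayer–Vietoris connecting map; compatibility of `q^*` with `δ` -/

section MV

variable (A B : Set Y) (hA : IsOpen A) (hB : IsOpen B)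

/-- **`q^*` commutes with the Mayer–Vietoris connecting maps** of `(A, B)` in `Y` and
`(q⁻¹A, q⁻¹B)` in `Z` (`subsetCochains.mvδ_pull`). [cite: HatcherAT2002, §3.1 p. 204] -/
theorem qH_mvδ (p : ℕ) (e : (subsetCochains R (SimplexSpan.coefR R) (A ∩ B)).homology p) :
    qH (R := R) q (A ∪ B) (p + 1) (mvδ R (SimplexSpan.coefR R) hA hB p e) =
      mvδ R (SimplexSpan.coefR R) (hA.preimage q.continuous) (hB.preimage q.continuous) p (qH (R := R) q (A ∩ B) p e) := by
  have h := congrArg (fun φ ↦ φ e) (mvδ_pull (N := SimplexSpan.coefR R) q A B hA hB p)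
  simp only [ModuleCat.comp_apply] at h
  exact h

/-- **The Mayer–Vietoris connecting map of `(q⁻¹A, q⁻¹B)` is `G`-equivariant.** Proof: `g`
preserves both preimages; naturality of `δ` under the map `g` (`mvδ_pull`) lands in the cover
`(g⁻¹q⁻¹A, g⁻¹q⁻¹B) ⊇ (q⁻¹A, q⁻¹B)`, and naturality under shrinking (`mvδ_natural`) brings it
back. [cite: HatcherAT2002, §3.1 p. 204] -/
theorem act_mvδ (g : G) (p : ℕ) (e : (subsetCochains R (SimplexSpan.coefR R) (q ⁻¹' A ∩ q ⁻¹' B)).homology p) :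
    act q horb (A ∪ B) g (p + 1) (mvδ R (SimplexSpan.coefR R) (hA.preimage q.continuous) (hB.preimage q.continuous) p e) =
      mvδ R (SimplexSpan.coefR R) (hA.preimage q.continuous) (hB.preimage q.continuous) p (act q horb (A ∩ B) g p e) := by
  have hAo := hA.preimage q.continuous
  have hBo := hB.preimage q.continuous
  have hA' : q ⁻¹' A ⊆ smulMap g ⁻¹' (q ⁻¹' A) := fun z hz ↦ mapsTo_smul q horb g A hz
  have hB' : q ⁻¹' B ⊆ smulMap g ⁻¹' (q ⁻¹' B) := fun z hz ↦ mapsTo_smul q horb g B hz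
  have hnat := congrArg (fun φ ↦ φ e) (mvδ_pull (N := SimplexSpan.coefR R) (smulMap (Z := Z) g) (q ⁻¹' A) (q ⁻¹' B) hAo hBo p)
  simp only [ModuleCat.comp_apply] at hnat
  unfold act
  rw [pullH_eq_resH_pullH (smulMap g) (mapsTo_smul q horb g (A ∪ B)) (union_subset_union hA' hB'),
    pullH_eq_resH_pullH (smulMap g) (mapsTo_smul q horb g (A ∩ B)) (inter_subset_inter hA' hB')]
  change resH _ (p + 1) (pullH (smulMap g) (mapsTo_preimage_union (smulMap g) (q ⁻¹' A) (q ⁻¹' B)) (p + 1)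
    (mvδ R (SimplexSpan.coefR R) hAo hBo p e)) = _
  rw [hnat]
  exact mvδ_natural_apply (N := SimplexSpan.coefR R) (hAo.preimage (smulMap g).continuous)
    (hBo.preimage (smulMap g).continuous) hAo hBo hA' hB' _

end MV

/-! ### §4 Tautness consequences and cofinality of the neighbourhoods `q⁻¹W` -/

section Taut

variable {N : ModuleCat.{max u v} R} {X : Type u} [TopologicalSpace X] {K : Set X}

omit [TopologicalSpace Z] [TopologicalSpace Y] [MulAction G Z] [ContinuousConstSMul G Z] in
/-- **Tautness, injectivity in use**: a class on an open neighbourhood `U` of a taut `K` which dies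
on `K` dies on some smaller open neighbourhood. [cite: Spanier1981, Ch. 6 §1, Thm. 10] -/
theorem exists_resH_eq_zero_of_taut (T : Cech.RetractionNhds K) {p : ℕ} {U : OpenNhd X K}
    (a : (subsetCochains R N U.carrier).homology p) (ha : resH U.subset p a = 0) :
    ∃ (V : OpenNhd X K) (h : U ≤ V), resH h p a = 0 := by
  have h0 : Cech.of R N U a = 0 :=
    T.injective_toSubset (R := R) (N := N) p (by rw [Cech.toSubset_of, ha, map_zero])
  exact (Cech.of_eq_zero_iff a).1 h0

omit [TopologicalSpace Z] [TopologicalSpace Y] [MulAction G Z] [ContinuousConstSMul G Z] in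
/-- **Tautness, surjectivity in use**: every class on a taut `K` is the restriction of a class on
an open neighbourhood inside any given one. [cite: Spanier1981, Ch. 6 §1, Thm. 10] -/
theorem exists_resH_eq_of_taut (T : Cech.RetractionNhds K) {p : ℕ} (U₀ : OpenNhd X K)
    (b : (subsetCochains R N K).homology p) :
    ∃ (U : OpenNhd X K), U₀ ≤ U ∧ ∃ a : (subsetCochains R N U.carrier).homology p,
      resH U.subset p a = b := by
  obtain ⟨z, hz⟩ := T.surjective_toSubset (R := R) (N := N) p b
  obtain ⟨U, hU, a, rfl⟩ := Cech.exists_of_le U₀ z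
  exact ⟨U, hU, a, by rw [← Cech.toSubset_of]; exact hz⟩

end Taut

section Cofinal

variable [CompactSpace Z] [T2Space Y]

omit [ContinuousConstSMul G Z] in
include horb in
/-- **Cofinality**: every open neighbourhood `V` of a `G`-stable `F ⊆ Z` contains `q⁻¹W` for some
open neighbourhood `W` of `q(F)` — namely `W = Y ∖ q(Z ∖ V)` (`Z` compact, `Y` Hausdorff, fibres
of `q` are orbits). [cite: Spanier1981, Ch. 6 §1, Thm. 10] -/
theorem exists_nhd_preimage_subset {F : Set Z} (hFG : ∀ (g : G) (z : Z), z ∈ F → g • z ∈ F)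
    {V : Set Z} (hV : IsOpen V) (hFV : F ⊆ V) :
    ∃ W : Set Y, IsOpen W ∧ q '' F ⊆ W ∧ q ⁻¹' W ⊆ V := by
  refine ⟨(q '' Vᶜ)ᶜ, (hV.isClosed_compl.isCompact.image q.continuous).isClosed.isOpen_compl, ?_, ?_⟩
  · rintro _ ⟨f, hf, rfl⟩ ⟨z, hz, hzf⟩
    obtain ⟨g, hg⟩ := (horb z f).1 hzf
    have hzF : z ∈ F := by
      have : g⁻¹ • f = z := by rw [← hg, inv_smul_smul]
      exact this ▸ hFG g⁻¹ f hf
    exact hz (hFV hzF)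
  · intro z hz
    by_contra hzV
    exact hz ⟨z, hzV, rfl⟩

end Cofinal

/-! ### §5 The theorem in the subset model -/

section Main

variable [Fintype G] [CompactSpace Z] [T2Space Z] [T2Space Y] [CharZero R]
  (hsurj : Function.Surjective q) {F : Set Z} (hFc : IsClosed F)
  (hFG : ∀ (g : G) (z : Z), z ∈ F → g • z ∈ F)
  (hfree : ∀ z : Z, z ∉ F → ∀ g : G, g • z = z → g = 1)
  (TF : Cech.RetractionNhds F) (TB : Cech.RetractionNhds (q '' F))

/-- `|G|` is invertible in a field of characteristic zero. [cite: Bredon1997, II Thm. 19.2] -/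
theorem isUnit_card : IsUnit (Fintype.card G : R) :=
  (Nat.cast_ne_zero.mpr Fintype.card_ne_zero).isUnit

omit [ContinuousConstSMul G Z] [Fintype G] [T2Space Z] [CharZero R] in
include hFc in
/-- The branch locus `q(F)` is closed. [cite: Bredon1997, II Thm. 19.2] -/
theorem isClosed_image : IsClosed (q '' F) :=
  (hFc.isCompact.image q.continuous).isClosed

omit [ContinuousConstSMul G Z] [Fintype G] [CompactSpace Z] [T2Space Z] [T2Space Y] [CharZero R] in
include hfree in
/-- The action is free over the complement of the branch locus. [cite: Bredon1997, II Thm. 19.2] -/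
theorem free_of_mem_compl {S : Set Y} (hS : S ⊆ (q '' F)ᶜ) (z : Z) (hz : q z ∈ S) (g : G)
    (hg : g • z = z) : g = 1 :=
  hfree z (fun hzF ↦ hS hz ⟨z, hzF, rfl⟩) g hg

omit [MulAction G Z] [ContinuousConstSMul G Z] [Fintype G] [CompactSpace Z] [T2Space Z] [T2Space Y]
  [CharZero R] in
/-- `Y = (Y ∖ q(F)) ∪ W` for every neighbourhood `W` of `q(F)`. [cite: Bredon1997, II Thm. 19.2] -/
theorem univ_subset_union (W : OpenNhd Y (q '' F)) : (univ : Set Y) ⊆ (q '' F)ᶜ ∪ W.carrier := by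
  intro y _
  by_cases hy : y ∈ q '' F
  · exact Or.inr (W.subset hy)
  · exact Or.inl hy

omit [MulAction G Z] [ContinuousConstSMul G Z] [Fintype G] [CompactSpace Z] [T2Space Z] [T2Space Y]
  [CharZero R] in
/-- `F ⊆ q⁻¹W` for every neighbourhood `W` of `q(F)`. [cite: Bredon1997, II Thm. 19.2] -/
theorem subset_preimage (W : OpenNhd Y (q '' F)) : F ⊆ q ⁻¹' W.carrier :=
  fun f hf ↦ W.subset ⟨f, hf, rfl⟩

omit [MulAction G Z] [ContinuousConstSMul G Z] [Fintype G] [CompactSpace Z] [T2Space Z] [T2Space Y]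
  [CharZero R] in
/-- `q⁻¹W' ⊆ q⁻¹W` for `W' ⊆ W` (neighbourhoods of `K` ordered by reverse inclusion). [cite: Bredon1997, II Thm. 19.2] -/
theorem pre_mono {K : Set Y} {W W' : OpenNhd Y K} (hW : W ≤ W') : q ⁻¹' W'.carrier ⊆ q ⁻¹' W.carrier :=
  preimage_mono hW

/-- The neighbourhood `q⁻¹W` of `F`. [cite: Bredon1997, II Thm. 19.2] -/
def preNhd (W : OpenNhd Y (q '' F)) : OpenNhd Z F :=
  ⟨q ⁻¹' W.carrier, W.isOpen.preimage q.continuous, subset_preimage q W⟩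

/-- The transfer map on the fixed locus, `q^* : H^p_Y(q(F)) → H^p_Z(F)`. [cite: Bredon1997, II §19] -/
abbrev rH (F : Set Z) (p : ℕ) :
    (subsetCochains R (SimplexSpan.coefR R) (q '' F)).homology p ⟶ (subsetCochains R (SimplexSpan.coefR R) F).homology p :=
  pullH (N := SimplexSpan.coefR R) q (Set.mapsTo_image q F) p

/-- The action of `g` on `H^p_Z(F)` (`F` is `G`-stable). [cite: Bredon1997, II §19] -/
abbrev actF (g : G) (p : ℕ) :
    (subsetCochains R (SimplexSpan.coefR R) F).homology p ⟶ (subsetCochains R (SimplexSpan.coefR R) F).homology p :=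
  pullH (N := SimplexSpan.coefR R) (smulMap g) (fun z hz ↦ hFG g z hz) p

omit [Fintype G] [CompactSpace Z] [T2Space Z] [T2Space Y] [CharZero R] in
/-- Restriction to `F` intertwines `q^*` on `W` with `q^*` on `q(F)`. [cite: Bredon1997, II Thm. 19.2] -/
theorem resH_F_qH (W : OpenNhd Y (q '' F)) (p : ℕ) (y : (subsetCochains R (SimplexSpan.coefR R) W.carrier).homology p) :
    resH (subset_preimage q W) p (qH (R := R) q W.carrier p y) = rH (R := R) q F p (resH W.subset p y) :=
  resH_pullH _ _ _ _ _ p y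

omit [Fintype G] [CompactSpace Z] [T2Space Z] [T2Space Y] [CharZero R] in
/-- Restriction to `F` intertwines the actions on `q⁻¹W` and on `F`. [cite: Bredon1997, II Thm. 19.2] -/
theorem resH_F_act (W : OpenNhd Y (q '' F)) (g : G) (p : ℕ)
    (x : (subsetCochains R (SimplexSpan.coefR R) (q ⁻¹' W.carrier)).homology p) :
    resH (subset_preimage q W) p (act q horb W.carrier g p x) =
      actF (R := R) hFG g p (resH (subset_preimage q W) p x) :=
  resH_pullH _ _ _ _ _ p x

omit [ContinuousConstSMul G Z] [Fintype G] [T2Space Z] [CharZero R] in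
include horb TF hFG in
/-- **Shrinking**: a class on `q⁻¹W` vanishing on `F` vanishes on `q⁻¹W'` for some smaller
neighbourhood `W'` of `q(F)` (tautness of `F` and cofinality of the `q⁻¹W`).
[cite: Spanier1981, Ch. 6 §1, Thm. 10] -/
theorem exists_shrink_eq_zero (W : OpenNhd Y (q '' F)) (p : ℕ)
    (x : (subsetCochains R (SimplexSpan.coefR R) (q ⁻¹' W.carrier)).homology p) (hx : resH (subset_preimage q W) p x = 0) :
    ∃ (W' : OpenNhd Y (q '' F)) (hW : W ≤ W'), resH (pre_mono q hW) p x = 0 := by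
  obtain ⟨V, hle, hV⟩ := exists_resH_eq_zero_of_taut (R := R) TF (U := preNhd q W) x hx
  obtain ⟨W₀, hW₀o, hBW₀, hW₀V⟩ := exists_nhd_preimage_subset q horb hFG V.isOpen V.subset
  let W' : OpenNhd Y (q '' F) := OpenNhd.inter W ⟨W₀, hW₀o, hBW₀⟩
  have hW' : W ≤ W' := fun y hy ↦ hy.1
  refine ⟨W', hW', ?_⟩
  have h1 : q ⁻¹' W'.carrier ⊆ V.carrier := fun z hz ↦ hW₀V hz.2
  have key : resH h1 p (resH hle p x) = 0 := by rw [hV, map_zero]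
  rw [resH_resH] at key
  exact key

omit [Fintype G] [T2Space Z] [CharZero R] in
include TF TB in
/-- **Descent along `F`**: an invariant class `x` on `q⁻¹W` becomes, on some smaller `q⁻¹W'`, the
pull-back of a class on `W'` — its restriction to `F` is `q^*` of a class on `q(F)` (transfer on
`F`), which extends to a neighbourhood (tautness of `q(F)`), and the two agree near `F` (tautness of
`F`). [cite: Spanier1981, Ch. 6 §1, Thm. 10] [cite: Bredon1997, II Thm. 19.2] -/
theorem exists_shrink_eq_qH
    (hrsurj : ∀ (p : ℕ) (x : (subsetCochains R (SimplexSpan.coefR R) F).homology p),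
      (∀ g : G, actF (R := R) hFG g p x = x) → ∃ y, rH (R := R) q F p y = x)
    (W : OpenNhd Y (q '' F)) (p : ℕ)
    (x : (subsetCochains R (SimplexSpan.coefR R) (q ⁻¹' W.carrier)).homology p) (hx : ∀ g : G, act q horb W.carrier g p x = x) :
    ∃ (W' : OpenNhd Y (q '' F)) (hW : W ≤ W') (b : (subsetCochains R (SimplexSpan.coefR R) W'.carrier).homology p),
      resH (pre_mono q hW) p x = qH (R := R) q W'.carrier p b := by
  -- the restriction of `x` to `F` is invariant, hence `q^* β`
  have hxF : ∀ g : G, actF (R := R) hFG g p (resH (subset_preimage q W) p x) =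
      resH (subset_preimage q W) p x := fun g ↦ by rw [← resH_F_act q horb hFG W g p x, hx g]
  obtain ⟨β, hβ⟩ := hrsurj p _ hxF
  -- `β` extends to a neighbourhood `W₁ ⊆ W`
  obtain ⟨W₁, hW₁, b₁, hb₁⟩ := exists_resH_eq_of_taut (R := R) TB W β
  -- the difference dies on `F`, hence on some `q⁻¹W₂`
  have hdiff : resH (subset_preimage q W₁) p
      (resH (pre_mono q hW₁) p x - qH (R := R) q W₁.carrier p b₁) = 0 := by
    rw [map_sub, resH_resH, resH_F_qH, hb₁, hβ]
    exact sub_self _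
  obtain ⟨W₂, hW₂, h0⟩ := exists_shrink_eq_zero q horb hFG TF W₁ p _ hdiff
  refine ⟨W₂, hW₁.trans hW₂, resH hW₂ p b₁, ?_⟩
  rw [map_sub, resH_resH, resH_qH, sub_eq_zero] at h0
  exact h0

include horb hsurj hFc hfree TF TB in
/-- **Injectivity of `q^* : H^p_Y(Y) → H^p_Z(Z)`** (subset model), for `F ⊆ Z` closed, `G`-stable,
containing the non-free locus, with `F` and `q(F)` taut and the transfer available on `F` itself.
Mayer–Vietoris for `Y = (Y ∖ q(F)) ∪ W` over shrinking neighbourhoods `W` of `q(F)`, the free case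
over `Y ∖ q(F)` and `W ∖ q(F)`, tautness near `q(F)`. [cite: Bredon1997, II Thm. 19.2] -/
theorem qH_univ_injective
    (hrinj : ∀ p, Function.Injective (rH (R := R) q F p))
    (hrsurj : ∀ (p : ℕ) (x : (subsetCochains R (SimplexSpan.coefR R) F).homology p),
      (∀ g : G, actF (R := R) hFG g p x = x) → ∃ y, rH (R := R) q F p y = x)
    (p : ℕ) : Function.Injective (qH (R := R) q (univ : Set Y) p) := by
  -- notation: `B = q(F)`, `U = Y ∖ B`
  have hBc : IsClosed (q '' F) := isClosed_image q hFc
  have hUo : IsOpen (q '' F)ᶜ := hBc.isOpen_compl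
  have hUfree : ∀ z : Z, q z ∈ (q '' F)ᶜ → ∀ g : G, g • z = z → g = 1 :=
    free_of_mem_compl q hfree subset_rfl
  have hG : IsUnit (Fintype.card G : R) := isUnit_card
  have huniv : ∀ W : OpenNhd Y (q '' F), (univ : Set Y) ⊆ (q '' F)ᶜ ∪ W.carrier :=
    univ_subset_union q
  rw [injective_iff_map_eq_zero]
  intro y hy
  -- (A) `y` dies on `U` (free case)
  have hyU : resH (subset_univ (q '' F)ᶜ) p y = 0 := by
    apply qH_injective_of_free q horb hsurj (q '' F)ᶜ hUfree p
    have h := resH_qH (R := R) q (subset_univ (q '' F)ᶜ) p y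
    change resH _ p (qH q univ p y) = _ at h
    rw [hy, map_zero] at h
    rw [map_zero]
    exact h.symm
  -- (B) `y` dies on `q(F)` (transfer on `F`), hence on a neighbourhood `W₀`
  have hyB : resH (OpenNhd.univ (q '' F)).subset p y = 0 := by
    apply hrinj p
    have h := resH_F_qH (R := R) q (OpenNhd.univ (q '' F)) p y
    change resH _ p (qH q univ p y) = _ at h
    rw [hy, map_zero] at h
    rw [map_zero]
    exact h.symm
  obtain ⟨W₀, hW₀, hyW₀⟩ :=
    exists_resH_eq_zero_of_taut (R := R) TB (U := OpenNhd.univ (q '' F)) y hyB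
  -- `y₀ = y|_{U ∪ W₀}`, the class in the total space of the Mayer–Vietoris sequence of `(U, W₀)`
  set y₀ := resH (subset_univ ((q '' F)ᶜ ∪ W₀.carrier)) p y with hy₀def
  have hy₀U : resH subset_union_left p y₀ = 0 := by rw [hy₀def, resH_resH]; exact hyU
  have hy₀W : resH subset_union_right p y₀ = 0 := by rw [hy₀def, resH_resH]; exact hyW₀
  suffices h : y₀ = 0 from
    resH_injective_of_subset (subset_univ _) (huniv W₀) p (h.trans (map_zero _).symm)
  rcases p with - | k
  · -- degree 0: `H⁰(U ∪ W₀) → H⁰(U) ⊞ H⁰(W₀)` is injective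
    apply mvRes_zero_injective (N := SimplexSpan.coefR R) hUo W₀.isOpen
    rw [map_zero, subsetCochains.biprod_decomp (mvRes R (SimplexSpan.coefR R) (q '' F)ᶜ W₀.carrier 0 y₀), fst_mvRes,
      snd_mvRes, hy₀U,
      hy₀W, map_zero, map_zero, add_zero]
  · -- degree k + 1: `y₀ = δ e`
    obtain ⟨e, he⟩ := exists_of_res_eq_zero (N := SimplexSpan.coefR R) hUo W₀.isOpen y₀ hy₀U hy₀W
    -- upstairs `δ (q^* e) = q^* y₀ = 0`, so `q^* e = a| - b|`
    have hUo' := hUo.preimage q.continuous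
    have hW₀o' := W₀.isOpen.preimage q.continuous
    have hδ : mvδ R (SimplexSpan.coefR R) hUo' hW₀o' k (qH (R := R) q ((q '' F)ᶜ ∩ W₀.carrier) k e) = 0 := by
      rw [← qH_mvδ q (q '' F)ᶜ W₀.carrier hUo W₀.isOpen k e, he, hy₀def, ← resH_qH q _ (k + 1) y]
      change resH _ (k + 1) (qH q univ (k + 1) y) = 0
      rw [hy, map_zero]
    obtain ⟨a, b, hab⟩ := exists_of_mvδ_eq_zero (N := SimplexSpan.coefR R) hUo' hW₀o' _ hδ
    -- average: `q^* e = aG| - bG|` with invariant `aG`, `bG`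
    set aG := avg q horb (S := (q '' F)ᶜ) hG k a with haGdef
    set bG := avg q horb (S := W₀.carrier) hG k b with hbGdef
    have hinv : ∀ g : G, act q horb ((q '' F)ᶜ ∩ W₀.carrier) g k
        (qH (R := R) q ((q '' F)ᶜ ∩ W₀.carrier) k e) = qH (R := R) q ((q '' F)ᶜ ∩ W₀.carrier) k e :=
      fun g ↦ act_qH q horb g k e
    have hab' : qH (R := R) q ((q '' F)ᶜ ∩ W₀.carrier) k e =
        resH (preimage_mono inter_subset_left) k aG - resH (preimage_mono inter_subset_right) k bG := by
      rw [← avg_eq_self q horb hG k _ hinv, hab, avg_sub, haGdef, hbGdef,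
        resH_avg q horb hG inter_subset_left, resH_avg q horb hG inter_subset_right]
      rfl
    -- free case on `U`: `aG = q^* a₀`
    obtain ⟨a₀, ha₀⟩ := exists_qH_eq_of_free q horb hsurj (q '' F)ᶜ hUfree k aG
      (fun g ↦ act_avg q horb hG g k a)
    -- descent along `F`: on some `W₂ ⊆ W₀`, `bG| = q^* b₂`
    obtain ⟨W₂, hW₂, b₂, hb₂⟩ := exists_shrink_eq_qH q horb hFG TF TB hrsurj W₀ k bG
      (fun g ↦ act_avg q horb hG g k b)
    -- restrict `e` to `U ∩ W₂`; there `q^* e₂ = q^*(a₀| - b₂|)`, so `e₂ = a₀| - b₂|`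
    set e₂ := resH (inter_subset_inter (subset_refl (q '' F)ᶜ) hW₂) k e with he₂def
    have hUW₂free : ∀ z : Z, q z ∈ (q '' F)ᶜ ∩ W₂.carrier → ∀ g : G, g • z = z → g = 1 :=
      free_of_mem_compl q hfree inter_subset_left
    have hqe₂ : qH (R := R) q ((q '' F)ᶜ ∩ W₂.carrier) k e₂ =
        resH (preimage_mono (inter_subset_inter (subset_refl (q '' F)ᶜ) hW₂)) k
          (qH (R := R) q ((q '' F)ᶜ ∩ W₀.carrier) k e) := by
      rw [he₂def, resH_qH]
    have he₂ : e₂ = resH inter_subset_left k a₀ - resH inter_subset_right k b₂ := by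
      apply qH_injective_of_free q horb hsurj ((q '' F)ᶜ ∩ W₂.carrier) hUW₂free k
      rw [hqe₂, hab', map_sub, map_sub, resH_resH, ← resH_qH, ← resH_qH, ha₀, ← hb₂, resH_resH,
        resH_resH]
    -- hence `δ e₂ = 0`, i.e. `y|_{U ∪ W₂} = 0`, i.e. `y₀ = 0`
    have hδ₂ : mvδ R (SimplexSpan.coefR R) hUo W₂.isOpen k e₂ = 0 := by
      rw [he₂, map_sub, mvδ_res_left, mvδ_res_right, sub_zero]
    have hy₂ : resH (union_subset_union (subset_refl (q '' F)ᶜ) hW₂) (k + 1) y₀ = 0 := by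
      rw [← he, mvδ_natural_apply (N := SimplexSpan.coefR R) hUo W₀.isOpen hUo W₂.isOpen (subset_refl _) hW₂, ← he₂def,
        hδ₂]
    have hinj2 := resH_injective_of_subset (N := SimplexSpan.coefR R) (subset_univ ((q '' F)ᶜ ∪ W₂.carrier)) (huniv W₂)
      (k + 1)
    have hy' : resH (subset_univ ((q '' F)ᶜ ∪ W₂.carrier)) (k + 1) y = 0 := by
      rw [← resH_resH (union_subset_union (subset_refl (q '' F)ᶜ) hW₂)
        (subset_univ ((q '' F)ᶜ ∪ W₀.carrier)), ← hy₀def, hy₂]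
    have hyz : y = 0 := hinj2 (hy'.trans (map_zero _).symm)
    rw [hy₀def, hyz, map_zero]

include horb hsurj hFc hfree TF TB in
/-- **Every `G`-invariant class of `H^p_Z(Z)` is `q^*` of a class of `H^p_Y(Y)`** (subset model),
under the same hypotheses as `qH_univ_injective`: the free case on `Y ∖ q(F)` gives `a₀`, descent
along `F` gives `b₂` on a neighbourhood `W₂` of `q(F)`, the two glue (Mayer–Vietoris, exactness at
`H(U) ⊞ H(W₂)`) to `y'`, and the defect `z - q^* y'` is `δ` of an invariant class of
`H(q⁻¹U ∩ q⁻¹W₂)` (averaging), i.e. `q^* δ e₀` (free case). [cite: Bredon1997, II Thm. 19.2] -/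
theorem exists_qH_univ_eq
    (hrsurj : ∀ (p : ℕ) (x : (subsetCochains R (SimplexSpan.coefR R) F).homology p),
      (∀ g : G, actF (R := R) hFG g p x = x) → ∃ y, rH (R := R) q F p y = x)
    (p : ℕ) (z : (subsetCochains R (SimplexSpan.coefR R) (q ⁻¹' (univ : Set Y))).homology p)
    (hz : ∀ g : G, act q horb (univ : Set Y) g p z = z) :
    ∃ y, qH (R := R) q (univ : Set Y) p y = z := by
  have hBc : IsClosed (q '' F) := isClosed_image q hFc
  have hUo : IsOpen (q '' F)ᶜ := hBc.isOpen_compl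
  have hUfree : ∀ z : Z, q z ∈ (q '' F)ᶜ → ∀ g : G, g • z = z → g = 1 :=
    free_of_mem_compl q hfree subset_rfl
  have hG : IsUnit (Fintype.card G : R) := isUnit_card
  have huniv : ∀ W : OpenNhd Y (q '' F), (univ : Set Y) ⊆ (q '' F)ᶜ ∪ W.carrier :=
    univ_subset_union q
  -- Step 1 (free case on `U`): `z|_{q⁻¹U} = q^* a₀`
  obtain ⟨a₀, ha₀⟩ := exists_qH_eq_of_free q horb hsurj (q '' F)ᶜ hUfree p
    (resH (preimage_mono (subset_univ (q '' F)ᶜ)) p z)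
    (fun g ↦ by rw [← resH_act q horb (subset_univ _) g p z, hz g])
  -- Step 2 (descent along `F`): `z|_{q⁻¹W₂} = q^* b₂` for some neighbourhood `W₂` of `q(F)`
  obtain ⟨W₂, hW₂, b₂, hb₂⟩ :=
    exists_shrink_eq_qH q horb hFG TF TB hrsurj (OpenNhd.univ (q '' F)) p z hz
  -- Step 3 (gluing): `a₀| = b₂|` on `U ∩ W₂` (their `q^*` agree; free case), so both come from `y'`
  have hUW₂free : ∀ z : Z, q z ∈ (q '' F)ᶜ ∩ W₂.carrier → ∀ g : G, g • z = z → g = 1 :=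
    free_of_mem_compl q hfree inter_subset_left
  have hagree : resH inter_subset_left p a₀ = resH inter_subset_right p b₂ := by
    apply qH_injective_of_free q horb hsurj ((q '' F)ᶜ ∩ W₂.carrier) hUW₂free p
    rw [← resH_qH, ← resH_qH, ha₀, ← hb₂, resH_resH, resH_resH]
    rfl
  obtain ⟨y', hy'U, hy'W⟩ := exists_of_res_eq_res (N := SimplexSpan.coefR R) hUo W₂.isOpen a₀ b₂ hagree
  -- Step 4: the defect `z' = z| - q^* y'` on `q⁻¹U ∪ q⁻¹W₂` dies on both pieces and is invariant
  have hUo' := hUo.preimage q.continuous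
  have hW₂o' := W₂.isOpen.preimage q.continuous
  set z' := resH (preimage_mono (subset_univ ((q '' F)ᶜ ∪ W₂.carrier))) p z -
    qH (R := R) q ((q '' F)ᶜ ∪ W₂.carrier) p y' with hz'def
  have hz'U : resH (subset_union_left : q ⁻¹' (q '' F)ᶜ ⊆ q ⁻¹' (q '' F)ᶜ ∪ q ⁻¹' W₂.carrier) p z' = 0 := by
    have h1 : resH (subset_union_left : q ⁻¹' (q '' F)ᶜ ⊆ q ⁻¹' (q '' F)ᶜ ∪ q ⁻¹' W₂.carrier) p z' =
        resH (preimage_mono (subset_univ (q '' F)ᶜ)) p z -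
          qH (R := R) q (q '' F)ᶜ p (resH subset_union_left p y') := by
      rw [hz'def, map_sub]
      exact congrArg₂ (· - ·) (resH_resH _ _ p z)
        (resH_qH q (subset_union_left : (q '' F)ᶜ ⊆ (q '' F)ᶜ ∪ W₂.carrier) p y')
    rw [h1, hy'U, ha₀, sub_self]
  have hz'W : resH (subset_union_right : q ⁻¹' W₂.carrier ⊆ q ⁻¹' (q '' F)ᶜ ∪ q ⁻¹' W₂.carrier) p z' = 0 := by
    have h1 : resH (subset_union_right : q ⁻¹' W₂.carrier ⊆ q ⁻¹' (q '' F)ᶜ ∪ q ⁻¹' W₂.carrier) p z' =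
        resH (pre_mono q hW₂) p z - qH (R := R) q W₂.carrier p (resH subset_union_right p y') := by
      rw [hz'def, map_sub]
      exact congrArg₂ (· - ·) (resH_resH _ _ p z)
        (resH_qH q (subset_union_right : W₂.carrier ⊆ (q '' F)ᶜ ∪ W₂.carrier) p y')
    rw [h1, hy'W, hb₂, sub_self]
  have hz'inv : ∀ g : G, act q horb ((q '' F)ᶜ ∪ W₂.carrier) g p z' = z' := fun g ↦ by
    rw [hz'def, map_sub, ← resH_act q horb (subset_univ _) g p z, hz g, act_qH]
  -- `q^*` of a class on `U ∪ W₂ = Y`, restricted to `Y`, versus `z`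
  have hlift : ∀ y'' : (subsetCochains R (SimplexSpan.coefR R) ((q '' F)ᶜ ∪ W₂.carrier)).homology p,
      qH (R := R) q ((q '' F)ᶜ ∪ W₂.carrier) p y'' =
        resH (preimage_mono (subset_univ ((q '' F)ᶜ ∪ W₂.carrier))) p z →
      qH (R := R) q univ p (resH (huniv W₂) p y'') = z := by
    intro y'' hy''
    rw [← resH_qH q (huniv W₂) p y'', hy'', resH_resH, resH_rfl]
  rcases p with - | k
  · -- degree 0: `z' = 0`
    have h0 : z' = 0 := by
      apply mvRes_zero_injective (N := SimplexSpan.coefR R) hUo' hW₂o'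
      rw [map_zero, subsetCochains.biprod_decomp (mvRes R (SimplexSpan.coefR R) (q ⁻¹' (q '' F)ᶜ) (q ⁻¹' W₂.carrier) 0 z'),
        fst_mvRes, snd_mvRes, hz'U, hz'W, map_zero, map_zero, add_zero]
    refine ⟨resH (huniv W₂) 0 y', hlift y' ?_⟩
    rw [hz'def, sub_eq_zero] at h0
    exact h0.symm
  · -- degree k + 1: `z' = δ e'`, `e'` may be averaged, then `e' = q^* e₀` and `z' = q^* (δ e₀)`
    obtain ⟨e', he'⟩ := exists_of_res_eq_zero (N := SimplexSpan.coefR R) hUo' hW₂o' z' hz'U hz'W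
    have heG : mvδ R (SimplexSpan.coefR R) hUo' hW₂o' k (avg q horb (S := (q '' F)ᶜ ∩ W₂.carrier) hG k e') = z' := by
      have h1 := map_avg q horb hG (S := (q '' F)ᶜ ∩ W₂.carrier) (S' := (q '' F)ᶜ ∪ W₂.carrier)
        (p := k) (p' := k + 1) (mvδ R (SimplexSpan.coefR R) hUo' hW₂o' k)
        (fun g x ↦ (act_mvδ q horb (q '' F)ᶜ W₂.carrier hUo W₂.isOpen g k x).symm) e'
      refine h1.trans ?_
      have h3 : avg q horb (S := (q '' F)ᶜ ∪ W₂.carrier) hG (k + 1) (mvδ R (SimplexSpan.coefR R) hUo' hW₂o' k e') =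
          avg q horb (S := (q '' F)ᶜ ∪ W₂.carrier) hG (k + 1) z' :=
        congrArg (avg q horb (S := (q '' F)ᶜ ∪ W₂.carrier) hG (k + 1)) he'
      exact h3.trans (avg_eq_self q horb hG (k + 1) z' hz'inv)
    have heGinv : ∀ g : G, act q horb ((q '' F)ᶜ ∩ W₂.carrier) g k
        (avg q horb (S := (q '' F)ᶜ ∩ W₂.carrier) hG k e') =
          avg q horb (S := (q '' F)ᶜ ∩ W₂.carrier) hG k e' :=
      fun g ↦ act_avg q horb (S := (q '' F)ᶜ ∩ W₂.carrier) hG g k e'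
    obtain ⟨e₀, he₀⟩ := exists_qH_eq_of_free q horb hsurj ((q '' F)ᶜ ∩ W₂.carrier) hUW₂free k
      (avg q horb (S := (q '' F)ᶜ ∩ W₂.carrier) hG k e') heGinv
    have hz' : qH (R := R) q ((q '' F)ᶜ ∪ W₂.carrier) (k + 1) (mvδ R (SimplexSpan.coefR R) hUo W₂.isOpen k e₀) = z' := by
      rw [qH_mvδ q (q '' F)ᶜ W₂.carrier hUo W₂.isOpen k e₀, he₀]
      exact heG
    refine ⟨resH (huniv W₂) (k + 1) (y' + mvδ R (SimplexSpan.coefR R) hUo W₂.isOpen k e₀), hlift _ ?_⟩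
    rw [map_add, hz', hz'def, add_sub_cancel]

end Main

end OrbitMap

end Literature.AlgebraicTopology.SingularHomology
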